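import Literature.MathematicalPhysics.QuantumFieldTheory.King1986.MinimizerBlockDecay
import Literature.MathematicalPhysics.QuantumFieldTheory.Balaban1983to89.B4Thm110ZeroTorusUniform
import HarnessLib

/-!
# King 1986, Theorem 3.3 ∕ Prop. 3.7 (3.64) and Prop. 3.8 (3.71) line 1 for the ACTUAL minimiser kernels — the constants
# UNIFORM IN THE MASS `0 ≤ m² ≤ m₀²` (resp. `0 < m² ≤ m₀²`): the mass-uniform twins of `minimiser_kernel_decay`
# (`MinimizerTowerBridge`), `minimiser_kernel_decay_labels` (`MinimizerTwoSpacingDecay`), `minimiser_kernel_decay_blocks` and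
# `king_prop38_torus_blocks` (`MinimizerBlockDecay`)

**Citation header (reproduction of PUBLISHED and PROVED work; seat `pub-ymgap-dag-n15-e` (generation 5) of the cell
`pub-ymgap`, Track-A node N15 = NE2, King-model rung; sequel of the n18-b chain `MinimizerTowerBridge` → `MinimizerTwoSpacingDecay`
→ `MinimizerBlockDecay` and of `Balaban1983to89/B4Thm110ZeroTorusUniform`).**  C. King, *The U(1) Higgs model. I. The continuum
limit*, Commun. Math. Phys. **102** (1986) 649–677 [King1986], Theorem 3.3 (3.7) p. 658, Prop. 3.7 (3.64) p. 663, Prop. 3.8 (3.71)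
p. 664, §4 pp. 672–674, and (2.20) p. 654 (the slice at scale `j` carries the mass `m²(L^jη)²`); [Ba 4] = T. Bałaban, *Regularity and
decay of lattice Green's functions*, Commun. Math. Phys. **89** (1983) 571–597 [Balaban1983RegularityDecay], Theorem (1.10) p. 573
(«constants … independent of A, k, Ω and depending on d, M only»).

**The point.**  The three King files above quantify the mass OUTSIDE their `∃ δ₀ c₀` («functions of `d, L, a, m²` only») because
their common root `B4Thm110ZeroTorus.thm110_zero_torus` did; `B4Thm110ZeroTorusUniform.thm110_zero_torus_unif` moves the mass
inside under a cap `m² ≤ m₀²`.  This file re-runs the three proofs VERBATIM on the uniform root; every other input of theirs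
(`king_prop38_torus_of_decay`: the Fourier-side constants `prop38RateConst` ∕ `prop38PosConst` ∕ `lemma43Const` carry no mass;
`aK_le`; the dictionaries `minimiser_toTor_eq`, `torEquiv`, `tdistT_blockOf_toTor`, `blockOf_over`) is mass-free.  Consumer: the
King-model rung of node N15 — summing the slice estimates of (2.17) over scales `j` (masses `m²(L^jη)² ∈ (0, m²]`) needs ONE
`(δ₀, c₀)` for all of them.

**What this file PROVES (kernel).**  `minimiser_kernel_decay_unif`, `minimiser_kernel_decay_labels_unif`,
**`minimiser_kernel_decay_blocks_unif`** (`∃ δ₀ c₀ > 0 ∀ volumes ∀ 0 ≤ m² ≤ m₀²: |ℋ_K(x, b)| ≤ a_K·c₀·e^{−δ₀·tdistT (B x) b}`) and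
**`king_prop38_torus_blocks_unif`** (`∃ δ₀ c₀ > 0 ∀ volumes ∀ n ≥ 1 ∀ 0 < m² ≤ m₀²: |ℋ_{K+n}(x′, b) − ℋ_K(x, b)| ≤
√((C₁ + C₂)(L^K)^{−γ}·2ac₀)·e^{−(δ₀∕2)·tdistT (B x) b}`) — the statements of the originals with `∀ m²` moved inside.

**NOT COVERED.**  The derivative ∕ Hölder lines (`MinimizerTwoSpacingDeriv`, `…Holder`: same re-run, on ask); `A ≠ 0`.  HONEST FRAMING:
King's `A = 0` scalar MODEL on finite tori; template literature; nothing about Bałaban's covariant objects; nothing continuum ∕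
mass-gap ∕ Clay; count-neutral for the cell's 27 nodes.
-/

noncomputable section

open Finset Real Matrix
open scoped BigOperators

namespace Literature.MathematicalPhysics.QuantumFieldTheory.King1986

open Literature.MathematicalPhysics.QuantumFieldTheory.Balaban1983to89 (Params)
open Literature.MathematicalPhysics.QuantumFieldTheory.Balaban1983to89.B5Prop11Plancherel
open Literature.MathematicalPhysics.QuantumFieldTheory.Balaban1983to89.B1RG242Torus (lvl lvl_of_le tower Qks extMat extMat_mulVec)
open Literature.MathematicalPhysics.QuantumFieldTheory.Balaban1983to89.B5Ineq137Torus (T blk)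

namespace Torus

variable {d : ℕ}

/-! ## §1 [Ba 4] (1.10) for the minimiser through the bridge, mass-uniform -/

/-- **Mass-uniform twin of `minimiser_kernel_decay`** (King's Theorem 3.3 ∕ Prop. 3.7 for `a_KG^ε_KQ^*_K` in tower labels): for
`d ≥ 1`, odd `L > 1`, `a > 0` and a cap `m₀² ≥ 0` there are `δ₀, c₀ > 0` such that for EVERY `0 ≤ m² ≤ m₀²`, every volume with
`K ≥ 1` and all `x, b, D` as there, `|ℋ_K(toTor x, toTorUnit b)| ≤ a_K·c₀·e^{−δ₀·εD}`.  Proof = the original's with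
`thm110_zero_torus_unif`. [cite: King1986, Theorem 3.3 p.658, Prop. 3.7 p.663; Balaban1983RegularityDecay, Theorem (1.10) p.573] -/
theorem minimiser_kernel_decay_unif (dd L : ℕ) (hd : 1 ≤ dd) (hL : Odd L ∧ 1 < L) {a : ℝ} (ha : 0 < a) {m0sq : ℝ}
    (hm0 : 0 ≤ m0sq) :
    ∃ δ₀ c₀ : ℝ, 0 < δ₀ ∧ 0 < c₀ ∧ ∀ (P : Params), P.d = dd → P.L = L → 1 ≤ P.K →
      ∀ (msq : ℝ), 0 ≤ msq → msq ≤ m0sq →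
      ∀ (M : Fin P.d → ℕ) [∀ μ, NeZero (M μ)] (hMK : ∀ μ, M μ = P.sitesPerDir P.K)
        (x : Balaban1983to89.Site P 0) (b : Balaban1983to89.Site P P.K) (D : ℝ), 0 ≤ D →
        (∀ z : Balaban1983to89.Site P 0, Balaban1983to89.Site.proj P.K P.K z = b →
          D ≤ Balaban1983to89.B5Ineq137Torus.T P 0 x z) →
        |minimiser (P.L ^ P.K) M (Balaban1983to89.B1.aSeq a P.L P.K) ((P.eps⁻¹) ^ 2) msq
            (Pi.single (toTorUnit P M hMK b) 1) (toTor P M hMK x)|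
          ≤ Balaban1983to89.B1.aSeq a P.L P.K * c₀ * Real.exp (-(δ₀ * (P.eps * D))) := by
  obtain ⟨δ₀, c₀, hδ₀, hc₀, H⟩ :=
    Balaban1983to89.B4Thm110ZeroTorus.thm110_zero_torus_unif dd L hd hL ha hm0
  refine ⟨δ₀, c₀, hδ₀, hc₀, ?_⟩
  intro P hPd hPL hK msq hmsq hcap M _ hMK x b D hD0 hD
  have hLr : (1 : ℝ) < P.L := by exact_mod_cast P.hL.2
  have haK : 0 < Balaban1983to89.B1.aSeq a P.L P.K := Balaban1983to89.B1.aSeq_pos ha hLr hK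
  -- the source `f = Q_K^* δ_b` is the indicator of the block of `b`
  have hf : ∀ z : Balaban1983to89.Site P 0,
      (Qks P P.K *ᵥ (Pi.single b (1 : ℝ) : Balaban1983to89.Site P P.K → ℝ)) z
        = if Balaban1983to89.Site.proj P.K P.K z = b then 1 else 0 := by
    intro z
    simp only [Qks]
    rw [extMat_mulVec, lvl_of_le P (Nat.le_add_left _ _), Pi.single_apply]
  have hF : ∀ z, |(Qks P P.K *ᵥ (Pi.single b (1 : ℝ) : Balaban1983to89.Site P P.K → ℝ)) z| ≤ 1 := by
    intro z; rw [hf z]; split_ifs <;> simp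
  have hsupp : ∀ z, (Qks P P.K *ᵥ (Pi.single b (1 : ℝ) : Balaban1983to89.Site P P.K → ℝ)) z ≠ 0 →
      D ≤ Balaban1983to89.B5Ineq137Torus.T P 0 x z := by
    intro z hz
    rw [hf z] at hz
    by_cases hb : Balaban1983to89.Site.proj P.K P.K z = b
    · exact hD z hb
    · rw [if_neg hb] at hz; exact absurd rfl hz
  have hmain := (H P hPd hPL msq hmsq hcap P.K hK le_rfl x _ 1 D hF hD0 hsupp).1
  rw [minimiser_toTor_eq P M hMK, abs_mul, abs_of_pos haK, mul_assoc]
  refine mul_le_mul_of_nonneg_left ?_ haK.le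
  simpa using hmain

/-- **Mass-uniform twin of `minimiser_kernel_decay_labels`** (the same in King's spelling `aK`, `N²`, for points with prescribed
labels). [cite: King1986, Theorem 3.3 p.658, Prop. 3.7 p.663; Balaban1983RegularityDecay, Theorem (1.10) p.573] -/
theorem minimiser_kernel_decay_labels_unif (dd L : ℕ) (hd : 1 ≤ dd) (hL : Odd L ∧ 1 < L) {a : ℝ} (ha : 0 < a)
    {m0sq : ℝ} (hm0 : 0 ≤ m0sq) :
    ∃ δ₀ c₀ : ℝ, 0 < δ₀ ∧ 0 < c₀ ∧ ∀ (P : Params), P.d = dd → P.L = L → 1 ≤ P.K →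
      ∀ (msq : ℝ), 0 ≤ msq → msq ≤ m0sq →
      ∀ (M : Fin P.d → ℕ) [∀ μ, NeZero (M μ)] (_hMK : ∀ μ, M μ = P.sitesPerDir P.K)
        (N : ℕ) [NeZero N] (_hN : N = P.L ^ P.K)
        (xt : Tor (fine N M)) (x : Balaban1983to89.Site P 0) (_hx : ∀ μ, (xt μ).val = (x μ).val)
        (bt : Tor M) (b : Balaban1983to89.Site P P.K) (_hb : ∀ μ, (bt μ).val = (b μ).val)
        (D : ℝ), 0 ≤ D →
        (∀ z : Balaban1983to89.Site P 0, Balaban1983to89.Site.proj P.K P.K z = b →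
          D ≤ Balaban1983to89.B5Ineq137Torus.T P 0 x z) →
        |minimiser N M (aK a P.L P.K) (((N : ℕ) : ℝ) ^ 2) msq (Pi.single bt 1) xt|
          ≤ aK a P.L P.K * c₀ * Real.exp (-(δ₀ * (P.eps * D))) := by
  obtain ⟨δ₀, c₀, hδ₀, hc₀, H⟩ := minimiser_kernel_decay_unif dd L hd hL ha hm0
  refine ⟨δ₀, c₀, hδ₀, hc₀, ?_⟩
  intro P hPd hPL hK msq hmsq hcap M _ hMK N _ hN xt x hx bt b hb D hD0 hD
  subst hN
  have hxt : xt = toTor P M hMK x := by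
    funext μ; apply ZMod.val_injective; rw [hx, val_toTor]
  have hbt : bt = toTorUnit P M hMK b := by
    funext μ; apply ZMod.val_injective; rw [hb, val_toTorUnit]
  subst hxt hbt
  rw [← aSeq_eq_aK, ← eps_inv_sq]
  exact H P hPd hPL hK msq hmsq hcap M hMK x b D hD0 hD

/-! ## §2 King's block-distance currency, mass-uniform -/

/-- **Mass-uniform twin of `minimiser_kernel_decay_blocks`** (King's Theorem 3.3 ∕ Prop. 3.7 (3.64) for `ℋ_K` in the unit-torus
distance from the block of the fine point): `∃ δ₀ c₀ > 0` (functions of `d, L, a, m₀²`) such that for EVERY `0 ≤ m² ≤ m₀²`, every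
volume, every spelling `N = L^K`, all `x, b`:  `|ℋ_K(x, b)| ≤ a_K·c₀·e^{−δ₀·tdistT M (B x) b}`.
[cite: King1986, Theorem 3.3 (3.7) p.658, Prop. 3.7 (3.64) p.663, (2.20) p.654; Balaban1983RegularityDecay, Theorem (1.10) p.573] -/
theorem minimiser_kernel_decay_blocks_unif (dd L : ℕ) (hd : 1 ≤ dd) (hL : Odd L ∧ 1 < L) {a : ℝ} (ha : 0 < a)
    {m0sq : ℝ} (hm0 : 0 ≤ m0sq) :
    ∃ δ₀ c₀ : ℝ, 0 < δ₀ ∧ 0 < c₀ ∧ ∀ (P : Params), P.d = dd → P.L = L → 1 ≤ P.K →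
      ∀ (msq : ℝ), 0 ≤ msq → msq ≤ m0sq →
      ∀ (M : Fin P.d → ℕ) [∀ μ, NeZero (M μ)] (_hMK : ∀ μ, M μ = P.sitesPerDir P.K)
        (N : ℕ) [NeZero N] (_hN : N = P.L ^ P.K) (xt : Tor (fine N M)) (bt : Tor M),
        |minimiser N M (aK a P.L P.K) (((N : ℕ) : ℝ) ^ 2) msq (Pi.single bt 1) xt|
          ≤ aK a P.L P.K * c₀ * Real.exp (-(δ₀ * tdistT M (blockOf N M xt) bt)) := by
  obtain ⟨δ₀, c₀, hδ₀, hc₀, H⟩ := minimiser_kernel_decay_labels_unif dd L hd hL ha hm0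
  refine ⟨δ₀, c₀ * Real.exp (2 * δ₀), hδ₀, by positivity, ?_⟩
  intro P hPd hPL hK msq hmsq hcap M _ hMK N _ hN xt bt
  subst hN
  have hLr : (1 : ℝ) < P.L := by exact_mod_cast P.hL.2
  have haK : 0 ≤ aK a P.L P.K := (aK_pos ha hLr hK).le
  set x : Balaban1983to89.Site P 0 := (torEquiv P M hMK).symm xt with hxdef
  set b : Balaban1983to89.Site P P.K := (torUnitEquiv P M hMK).symm bt with hbdef
  have hxt : toTor P M hMK x = xt := (torEquiv P M hMK).apply_symm_apply xt
  have hbt : toTorUnit P M hMK b = bt := (torUnitEquiv P M hMK).apply_symm_apply bt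
  have hx : ∀ μ, (xt μ).val = (x μ).val := fun μ => by rw [← hxt, val_toTor]
  have hb : ∀ μ, (bt μ).val = (b μ).val := fun μ => by rw [← hbt, val_toTorUnit]
  have hε : 0 < P.eps := Params.eps_pos P
  set TK : ℝ := T P P.K (blk P P.K x) b with hTKdef
  set D : ℝ := max 0 ((TK - 2) / P.eps) with hDdef
  have hD0 : 0 ≤ D := le_max_left _ _
  have hDle : ∀ z : Balaban1983to89.Site P 0, Balaban1983to89.Site.proj P.K P.K z = b → D ≤ T P 0 x z := by
    intro z hz
    rcases le_total ((TK - 2) / P.eps) 0 with h | h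
    · rw [hDdef, max_eq_left h]
      exact Balaban1983to89.B5Ineq137Torus.T_nonneg P 0 x z
    · rw [hDdef, max_eq_right h, div_le_iff₀ hε]
      have hdom := T_blk_le_eps_mul P x z
      rw [blk_eq_proj P z, hz] at hdom
      linarith [mul_comm P.eps (T P 0 x z)]
  have hεD : TK - 2 ≤ P.eps * D := by
    have h1 : P.eps * ((TK - 2) / P.eps) ≤ P.eps * D :=
      mul_le_mul_of_nonneg_left (le_max_right _ _) hε.le
    rwa [mul_div_cancel₀ _ hε.ne'] at h1
  have hmain := H P hPd hPL hK msq hmsq hcap M hMK (P.L ^ P.K) rfl xt x hx bt b hb D hD0 hDle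
  have hexp : Real.exp (-(δ₀ * (P.eps * D))) ≤ Real.exp (2 * δ₀) * Real.exp (-(δ₀ * TK)) := by
    rw [← Real.exp_add]
    apply Real.exp_le_exp.mpr
    nlinarith [mul_le_mul_of_nonneg_left hεD hδ₀.le]
  have hTKeq : tdistT M (blockOf (P.L ^ P.K) M xt) bt = TK := by
    rw [← hxt, ← hbt, tdistT_blockOf_toTor]
  rw [hTKeq]
  calc |minimiser (P.L ^ P.K) M (aK a P.L P.K) ((((P.L ^ P.K : ℕ) : ℝ)) ^ 2) msq (Pi.single bt 1) xt|
      ≤ aK a P.L P.K * c₀ * Real.exp (-(δ₀ * (P.eps * D))) := hmain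
    _ ≤ aK a P.L P.K * c₀ * (Real.exp (2 * δ₀) * Real.exp (-(δ₀ * TK))) :=
        mul_le_mul_of_nonneg_left hexp (mul_nonneg haK hc₀.le)
    _ = aK a P.L P.K * (c₀ * Real.exp (2 * δ₀)) * Real.exp (-(δ₀ * TK)) := by ring

/-- **Mass-uniform twin of `king_prop38_torus_blocks`** (King's (3.71), first line, in block-distance currency): `∃ δ₀ c₀ > 0`
(functions of `d, L, a, m₀², γ`-free) such that for EVERY `0 < m² ≤ m₀²`, every volume with `K ≥ 1`, every `n ≥ 1`, every unit site
`b` and fine points `x′` over `x`: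
`|ℋ_{K+n}(x′, b) − ℋ_K(x, b)| ≤ √((C₁ + C₂)(L^K)^{−γ}·2ac₀)·e^{−(δ₀∕2)·tdistT M (B x) b}` — the one pair of constants the slices of
(2.17) at all scales `j` (masses `m²(L^jη)²`) share. [cite: King1986, Prop. 3.8 (3.71) p.664, p.674, (2.20) p.654] -/
theorem king_prop38_torus_blocks_unif (dd L : ℕ) (hd : 1 ≤ dd) (hLodd : Odd L) (hL : 2 ≤ L) {a : ℝ} (ha : 0 < a)
    {m0sq : ℝ} (hm0 : 0 ≤ m0sq) {γ : ℝ} (hγ0 : 0 ≤ γ) (hγ1 : γ ≤ 1) :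
    ∃ δ₀ c₀ : ℝ, 0 < δ₀ ∧ 0 < c₀ ∧ ∀ (P : Params) (_hPd : P.d = dd) (_hPL : P.L = L) (_hK : 1 ≤ P.K) [NeZero P.L]
      (m2 : ℝ) (_hm : 0 < m2) (_hcap : m2 ≤ m0sq)
      (n : ℕ) (_hn : 1 ≤ n) (M : Fin P.d → ℕ) [∀ μ, NeZero (M μ)] (_hMK : ∀ μ, M μ = P.sitesPerDir P.K)
      (xt : Tor (fine (P.L ^ P.K) M)) (xt' : Tor (fine (P.L ^ n * P.L ^ P.K) M)) (bt : Tor M)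
      (_hxx : ∀ μ, (xt μ).val = (xt' μ).val / P.L ^ n),
      |minimiser (P.L ^ n * P.L ^ P.K) M (aK a P.L (P.K + n)) (((P.L ^ n * P.L ^ P.K : ℕ) : ℝ) ^ 2) m2
            (Pi.single bt 1) xt'
          - minimiser (P.L ^ P.K) M (aK a P.L P.K) (((P.L ^ P.K : ℕ) : ℝ) ^ 2) m2 (Pi.single bt 1) xt|
        ≤ Real.sqrt (((prop38RateConst a a (lemma43Const a P.L P.K n) ((π ^ 2 / 4) ^ P.d) P.d γ
                + prop38PosConst a ((π ^ 2 / 4) ^ P.d) P.d γ) * ((P.L ^ P.K : ℕ) : ℝ) ^ (-γ)) * (2 * (a * c₀)))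
            * Real.exp (-(δ₀ / 2 * tdistT M (blockOf (P.L ^ P.K) M xt) bt)) := by
  have hL1 : 1 < L := by omega
  obtain ⟨δ₀, c₀, hδ₀, hc₀, H⟩ := minimiser_kernel_decay_blocks_unif dd L hd ⟨hLodd, hL1⟩ ha hm0
  refine ⟨δ₀, c₀, hδ₀, hc₀, ?_⟩
  intro P hPd hPL hK _ m2 hm hcap n hn M _ hMK xt xt' bt hxx
  have hLr : (1 : ℝ) < P.L := by exact_mod_cast P.hL.2
  have hPd0 : 0 < P.d := by have := P.hd; omega
  have hPodd : Odd P.L := P.hL.1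
  have hPL2 : 2 ≤ P.L := by have := P.hL.2; omega
  -- run A: volume `P`
  have hA := H P hPd hPL hK m2 hm.le hcap M hMK (P.L ^ P.K) rfl xt bt
  have hdecA : |minimiser (P.L ^ P.K) M (aK a P.L P.K) (((P.L ^ P.K : ℕ) : ℝ) ^ 2) m2 (Pi.single bt 1) xt|
      ≤ a * c₀ * Real.exp (-(δ₀ * tdistT M (blockOf (P.L ^ P.K) M xt) bt)) :=
    hA.trans (mul_le_mul_of_nonneg_right (mul_le_mul_of_nonneg_right (aK_le ha hLr hK) hc₀.le)
      (Real.exp_pos _).le)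
  -- run B: volume `(d, L, m, K + n)` over the same unit torus
  have hMK' : ∀ μ, M μ = (⟨P.d, P.L, P.m, P.K + n, P.hd, P.hL⟩ : Params).sitesPerDir (P.K + n) := fun μ => by
    rw [hMK μ]; exact (sitesPerDir_finerVolume P n).symm
  have hN : P.L ^ n * P.L ^ P.K = P.L ^ (P.K + n) := by rw [pow_add, mul_comm]
  have hB := H (⟨P.d, P.L, P.m, P.K + n, P.hd, P.hL⟩ : Params) hPd hPL (show 1 ≤ P.K + n by omega) m2 hm.le hcap M hMK'
    (P.L ^ n * P.L ^ P.K) hN xt' bt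
  rw [blockOf_over M xt xt' hxx] at hB
  have hdecB : |minimiser (P.L ^ n * P.L ^ P.K) M (aK a P.L (P.K + n)) (((P.L ^ n * P.L ^ P.K : ℕ) : ℝ) ^ 2) m2
        (Pi.single bt 1) xt'| ≤ a * c₀ * Real.exp (-(δ₀ * tdistT M (blockOf (P.L ^ P.K) M xt) bt)) :=
    hB.trans (mul_le_mul_of_nonneg_right (mul_le_mul_of_nonneg_right
      (aK_le ha hLr (show 1 ≤ P.K + n by omega)) hc₀.le) (Real.exp_pos _).le)
  exact king_prop38_torus_of_decay hPd0 hPodd hPL2 hK hn M ha hm hγ0 hγ1 bt xt xt' hxx hdecA hdecB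

end Torus

end Literature.MathematicalPhysics.QuantumFieldTheory.King1986
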